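import Literature.AlgebraicGeometry.Frobenioids.EquivalenceFrobeniusEndomorphisms
import HarnessLib

/-!
# Frobenioids I, §3: Theorem 3.4 (iii), steps (F1), (F2) — from the CONCLUSION of Theorem 3.4 (ii)
# (isotropic type, non-dilating monoids; no hypothesis on the base categories)

Mochizuki, *The geometry of Frobenioids I: the general theory*, Kyushu J. Math. **62** (2008),
Thm. 3.4 (iii), proof, assertion (F1), kurims p. 65: "Since [by assertion (ii)] `Ψ` preserves
pre-steps, it thus follows formally from the characterization of 'Div-identity prime-Frobenius
endomorphisms' given in Proposition 1.14, (v), that `Ψ` maps `φ₁` to a prime-Frobenius endomorphism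
of `A₂ = Ψ(A₁)`" [cite: MochizukiFrdI2008, Thm. 3.4 (iii) p.65].

PROOF-ONLY (seat abc-iut-L1-t13, gen 2; the cell's repair programme for Thm. 3.4). The printed proof
of Thm. 3.4 (iii) uses the base hypothesis "`D₁`, `D₂` of FSMFF-type" ONLY through assertion (ii)
("`Ψ` preserves pre-steps … and group-like objects"). The landed files of this seat's lineage
(`EquivalenceFrobeniusEndomorphisms.lean`, `EquivalenceFrobeniusType.lean`,
`EquivalenceLinearMorphisms.lean`, `EquivalenceFrobeniusDegrees.lean`,
`EquivalenceFrobeniusQuasiIsotropic.lean`) ran that proof with (ii) in the form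
`FrdI.isPreStep_map_of_isOfFSMType`, i.e. over bases of FSM-type. This file and its four companions
(`…FromPreSteps.lean`) re-run the SAME proofs with (ii) abstracted into HYPOTHESES — for an
equivalence `Ψ : C₁ ⥲ C₂`:

* `hps`  : `Ψ` maps pre-steps of `C₁` to pre-steps of `C₂`;
* `hps'` : `Ψ⁻¹` maps pre-steps of `C₂` to pre-steps of `C₁`;
* `hgl`  : `Ψ` maps group-like objects to group-like objects;
* `hgl'` : `Ψ⁻¹` maps group-like objects to group-like objects

(each theorem carries exactly the ones it uses) — so that the morphism part of Thm. 3.4 (iii) becomes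
available over EVERY class of bases for which (ii) is in the tree: bases of FSM-type (this lineage,
p409721), bases of FSMFF-type in the author's REVISED (2024) sense (seat abc-iut-L1-t11's
`FrdI.thm34ii_of_isOfFSMFFType2024`, *Comments* (28) [cite: MochizukiFrdIComments2024, (28) p.3]),
and, verbatim, the typed 2008-worded `PreFrobenioidData.Thm34ii` as a hypothesis. Here: (F1) — a
`Div`-identity prime-Frobenius endomorphism of a non-group-like object is mapped to one
(`FrdI.isDivIdentity_isPrimeFrobenius_map_ps`, Prop. 1.14 (v) transported along `Ψ`) — and the
pre-step case of (F2) (`FrdI.isPrimeFrobenius_map_iff_of_isPreStep_ps`); the pull-back case of (F2)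
needs no base hypothesis and is the landed `FrdI.isPrimeFrobenius_map_iff_of_isPullbackMorphism`.
No statement of the paper is restated or strengthened; nothing here bears on [IUTchIII] Cor. 3.12.
-/

set_option backward.isDefEq.respectTransparency false

namespace Literature.AlgebraicGeometry.Frobenioids

open CategoryTheory Opposite

universe w v v' u u'

namespace FrdI

section Two

variable {D₁ : Type u} [Category.{v} D₁] {Φ₁ : D₁ᵒᵖ ⥤ CommMonCat.{w}} {C₁ : Type u'}
  [Category.{v'} C₁] {D₂ : Type u} [Category.{v} D₂] {Φ₂ : D₂ᵒᵖ ⥤ CommMonCat.{w}} {C₂ : Type u'}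
  [Category.{v'} C₂] {F₁ : C₁ ⥤ ElemFrobenioid Φ₁} {F₂ : C₂ ⥤ ElemFrobenioid Φ₂}

/-- If `Ψ` preserves pre-steps, it maps steps to steps (isomorphisms are reflected).
[cite: MochizukiFrdI2008, Thm. 3.4 (ii) p.62] -/
theorem isStep_map_ps (Ψ : C₁ ≌ C₂)
    (hps : ∀ ⦃X Y : C₁⦄ ⦃f : X ⟶ Y⦄, PreFrobenioid.IsPreStep F₁ f →
      PreFrobenioid.IsPreStep F₂ (Ψ.functor.map f))
    {A B : C₁} {α : A ⟶ B} (hα : PreFrobenioid.IsStep F₁ α) :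
    PreFrobenioid.IsStep F₂ (Ψ.functor.map α) :=
  ⟨hps hα.1, fun _ => hα.2 (isIso_of_fully_faithful Ψ.functor α)⟩

/-- If `Ψ⁻¹` preserves pre-steps, a pre-step `Ψ(φ)` comes from a pre-step `φ` (conjugate by the
unit). [cite: MochizukiFrdI2008, Thm. 3.4 (ii) p.62] -/
theorem isPreStep_of_map_ps (Ψ : C₁ ≌ C₂)
    (hps' : ∀ ⦃X Y : C₂⦄ ⦃g : X ⟶ Y⦄, PreFrobenioid.IsPreStep F₂ g →
      PreFrobenioid.IsPreStep F₁ (Ψ.inverse.map g))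
    {A B : C₁} {φ : A ⟶ B} (h : PreFrobenioid.IsPreStep F₂ (Ψ.functor.map φ)) :
    PreFrobenioid.IsPreStep F₁ φ := by
  have h1 := hps' h
  rw [Ψ.inv_fun_map] at h1
  have e : φ = Ψ.unit.app A ≫ (Ψ.unitInv.app A ≫ φ ≫ Ψ.unit.app B) ≫ Ψ.unitInv.app B := by simp
  rw [e]
  exact PreFrobenioid.IsPreStep.comp F₁ (PreFrobenioid.isPreStep_of_isIso F₁ _)
    (PreFrobenioid.IsPreStep.comp F₁ h1 (PreFrobenioid.isPreStep_of_isIso F₁ _))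

/-- If `Ψ⁻¹` preserves group-like objects, a non-group-like object is mapped by `Ψ` to a
non-group-like object. [cite: MochizukiFrdI2008, Thm. 3.4 (ii) p.62] -/
theorem not_isGroupLikeObj_map_ps (hP₁ : IsPreFrobenioid Φ₁ F₁) (Ψ : C₁ ≌ C₂)
    (hgl' : ∀ ⦃Y : C₂⦄, PreFrobenioid.IsGroupLikeObj F₂ Y →
      PreFrobenioid.IsGroupLikeObj F₁ (Ψ.inverse.obj Y))
    {A : C₁} (hA : ¬ PreFrobenioid.IsGroupLikeObj F₁ A) :
    ¬ PreFrobenioid.IsGroupLikeObj F₂ (Ψ.functor.obj A) := fun hGA =>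
  hA (isGroupLikeObj_of_iso hP₁ (Ψ.unitIso.app A).symm (hgl' hGA))

/-- **Thm. 3.4 (iii), (F1) core: `Ψ` preserves `Div`-identity prime-Frobenius endomorphisms of
non-group-like objects** — Frobenioids of isotropic type, `Φ₂` non-dilating, assuming that `Ψ` and
`Ψ⁻¹` preserve pre-steps and `Ψ⁻¹` preserves group-like objects (via Prop. 1.14 (v)).
[cite: MochizukiFrdI2008, Thm. 3.4 (iii) p.65] -/
theorem isDivIdentity_isPrimeFrobenius_map_ps (hF₁ : PreFrobenioid.IsFrobenioid F₁)
    (hF₂ : PreFrobenioid.IsFrobenioid F₂) (hi₁ : ∀ A : C₁, PreFrobenioid.IsIsotropic F₁ A)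
    (hi₂ : ∀ A : C₂, PreFrobenioid.IsIsotropic F₂ A) (hnd₂ : IsNonDilatingOn Φ₂) (Ψ : C₁ ≌ C₂)
    (hps : ∀ ⦃X Y : C₁⦄ ⦃f : X ⟶ Y⦄, PreFrobenioid.IsPreStep F₁ f →
      PreFrobenioid.IsPreStep F₂ (Ψ.functor.map f))
    (hps' : ∀ ⦃X Y : C₂⦄ ⦃g : X ⟶ Y⦄, PreFrobenioid.IsPreStep F₂ g →
      PreFrobenioid.IsPreStep F₁ (Ψ.inverse.map g))
    (hgl' : ∀ ⦃Y : C₂⦄, PreFrobenioid.IsGroupLikeObj F₂ Y →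
      PreFrobenioid.IsGroupLikeObj F₁ (Ψ.inverse.obj Y))
    {A : C₁} (hA : ¬ PreFrobenioid.IsGroupLikeObj F₁ A)
    {φ : A ⟶ A} (hdi : PreFrobenioid.IsDivIdentity F₁ φ) (hpf : PreFrobenioid.IsPrimeFrobenius F₁ φ) :
    PreFrobenioid.IsDivIdentity F₂ (Ψ.functor.map φ) ∧
      PreFrobenioid.IsPrimeFrobenius F₂ (Ψ.functor.map φ) := by
  have hP₁ := hF₁.isPreFrobenioid
  refine PreFrobenioid.isDivIdentity_isPrimeFrobenius_of_squares F₂ hF₂ hi₂ hnd₂ ?_ ?_ ?_ ?_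
  · -- `Ψ φ` is not a pre-step (else `φ` would be one, of prime degree)
    intro h
    have h1 := isPreStep_of_map_ps Ψ hps' h
    have hd : (PreFrobenioid.degFr F₁ φ : ℕ) = 1 := by
      rw [show PreFrobenioid.degFr F₁ φ = 1 from h1.1, PNat.one_coe]
    exact (Nat.Prime.one_lt hpf.2).ne' hd
  · exact (hpf.isIrreducibleHom hF₁ (hi₁ A)).map_equivalence Ψ
  · -- `Ψ A` is not group-like
    exact not_isGroupLikeObj_map_ps hP₁ Ψ hgl' hA
  · -- the squares of Prop. 1.14 (v), transported along `Ψ`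
    intro B₂ α₂ hα₂
    -- pull the step back to `C₁`
    let α₁ : A ⟶ Ψ.inverse.obj B₂ := Ψ.unit.app A ≫ Ψ.inverse.map α₂
    have hα₁p : PreFrobenioid.IsPreStep F₁ α₁ :=
      PreFrobenioid.IsPreStep.comp F₁ (PreFrobenioid.isPreStep_of_isIso F₁ _) (hps' hα₂.1)
    have hα₁ : PreFrobenioid.IsStep F₁ α₁ := by
      refine ⟨hα₁p, fun h => hα₂.2 ?_⟩
      haveI : IsIso (Ψ.unit.app A ≫ Ψ.inverse.map α₂) := h
      haveI : IsIso (Ψ.inverse.map α₂) := IsIso.of_isIso_comp_left (Ψ.unit.app A) (Ψ.inverse.map α₂)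
      exact isIso_of_fully_faithful Ψ.inverse α₂
    obtain ⟨B', ψ₁, β₁, ⟨hψirr, hψnps⟩, hβ₁, hsq⟩ :=
      PreFrobenioid.exists_square_of_isDivIdentity_isPrimeFrobenius F₁ hF₁ hi₁ hdi hpf α₁ hα₁
    -- hsq : α₁ ≫ ψ₁ = φ ≫ α₁ ≫ β₁ ; push forward: `Ψ α₁ = α₂ ≫ ε⁻¹`
    have hmap : Ψ.functor.map α₁ = α₂ ≫ Ψ.counitInv.app B₂ := by
      simp only [α₁, Functor.map_comp, Equivalence.fun_inv_map, Equivalence.functor_unit_comp_assoc]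
    have hsq₂ := congrArg Ψ.functor.map hsq
    simp only [Functor.map_comp, hmap, Category.assoc] at hsq₂
    -- hsq₂ : α₂ ≫ ε⁻¹ ≫ Ψ ψ₁ = Ψ φ ≫ α₂ ≫ ε⁻¹ ≫ Ψ β₁
    refine ⟨Ψ.functor.obj B', Ψ.counitInv.app B₂ ≫ Ψ.functor.map ψ₁,
      Ψ.counitInv.app B₂ ≫ Ψ.functor.map β₁, ⟨?_, ?_⟩, ⟨?_, ?_⟩, hsq₂⟩
    · exact (hψirr.map_equivalence Ψ).of_arrow_iso (Ψ.counitIso.app B₂) (Iso.refl _) (by simp)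
    · intro h
      apply hψnps
      apply isPreStep_of_map_ps Ψ hps'
      have e : Ψ.functor.map ψ₁ = Ψ.counit.app B₂ ≫ (Ψ.counitInv.app B₂ ≫ Ψ.functor.map ψ₁) := by simp
      rw [e]
      exact PreFrobenioid.IsPreStep.comp F₂ (PreFrobenioid.isPreStep_of_isIso F₂ _) h
    · exact PreFrobenioid.IsPreStep.comp F₂ (PreFrobenioid.isPreStep_of_isIso F₂ _)
        (isStep_map_ps Ψ hps hβ₁).1
    · intro h
      haveI : IsIso (Ψ.counitInv.app B₂ ≫ Ψ.functor.map β₁) := h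
      exact (isStep_map_ps Ψ hps hβ₁).2
        (IsIso.of_isIso_comp_left (Ψ.counitInv.app B₂) (Ψ.functor.map β₁))

/-! ### (F2): admissibility propagates along pre-steps -/

/-- **(F2), pre-step case.** Along a pre-step `ζ : A → B`, the images of the `p₁`-Frobenius
morphisms out of `A` and out of `B` are simultaneously prime-Frobenius, of the same degree (Frobenius
conjugation, Prop. 1.10 (i); Prop. 1.14 (iv) applied to the image square, whose pre-step sides keep
degree `1` because `Ψ` preserves pre-steps). [cite: MochizukiFrdI2008, Thm. 3.4 (iii) p.65] -/
theorem isPrimeFrobenius_map_iff_of_isPreStep_ps (hF₁ : PreFrobenioid.IsFrobenioid F₁)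
    (hF₂ : PreFrobenioid.IsFrobenioid F₂) (hi₁ : ∀ A : C₁, PreFrobenioid.IsIsotropic F₁ A)
    (hi₂ : ∀ A : C₂, PreFrobenioid.IsIsotropic F₂ A) (Ψ : C₁ ≌ C₂)
    (hps : ∀ ⦃X Y : C₁⦄ ⦃f : X ⟶ Y⦄, PreFrobenioid.IsPreStep F₁ f →
      PreFrobenioid.IsPreStep F₂ (Ψ.functor.map f))
    {A B A' B' : C₁} {ζ : A ⟶ B} (hζ : PreFrobenioid.IsPreStep F₁ ζ) {fA : A ⟶ A'} {fB : B ⟶ B'}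
    (hfA : PreFrobenioid.IsFrobeniusType F₁ fA) (hfB : PreFrobenioid.IsFrobeniusType F₁ fB)
    (hd : PreFrobenioid.degFr F₁ fA = PreFrobenioid.degFr F₁ fB)
    (hp : (PreFrobenioid.degFr F₁ fA : ℕ).Prime) :
    (PreFrobenioid.IsPrimeFrobenius F₂ (Ψ.functor.map fA) ↔
        PreFrobenioid.IsPrimeFrobenius F₂ (Ψ.functor.map fB)) ∧
      PreFrobenioid.degFr F₂ (Ψ.functor.map fA) = PreFrobenioid.degFr F₂ (Ψ.functor.map fB) := by
  obtain ⟨ζ', hsq, -⟩ := PreFrobenioid.existsUnique_frobeniusConjugate hF₁ ζ hfA hfB hd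
  -- hsq : fA ≫ ζ' = ζ ≫ fB
  have hζ' : PreFrobenioid.IsPreStep F₁ ζ' := hζ.frobeniusConjugate hF₁ hsq hfA hfB hd
  have hsq₂ : Ψ.functor.map ζ ≫ Ψ.functor.map fB = Ψ.functor.map fA ≫ Ψ.functor.map ζ' := by
    rw [← Functor.map_comp, ← Functor.map_comp, hsq]
  have h1 : PreFrobenioid.degFr F₂ (Ψ.functor.map ζ) = PreFrobenioid.degFr F₂ (Ψ.functor.map ζ') := by
    rw [show PreFrobenioid.degFr F₂ (Ψ.functor.map ζ) = 1 from (hps hζ).1,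
      show PreFrobenioid.degFr F₂ (Ψ.functor.map ζ') = 1 from (hps hζ').1]
  have hpA : PreFrobenioid.IsPrimeFrobenius F₁ fA := ⟨hfA, hp⟩
  have hpB : PreFrobenioid.IsPrimeFrobenius F₁ fB := ⟨hfB, by rw [← hd]; exact hp⟩
  obtain ⟨hiff, hdeg⟩ := PreFrobenioid.isPrimeFrobenius_iff_of_square F₂ hF₂ hi₂ hsq₂ h1
    ((hpB.isIrreducibleHom hF₁ (hi₁ _)).map_equivalence Ψ)
    ((hpA.isIrreducibleHom hF₁ (hi₁ _)).map_equivalence Ψ)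
  exact ⟨hiff.symm, hdeg.symm⟩

end Two

end FrdI

end Literature.AlgebraicGeometry.Frobenioids
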